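import Mathlib
import HarnessLib
import Literature.Combinatorics.Additive.StepBeyondKempermanCheckpoint
import Literature.Combinatorics.Additive.StepBeyondKempermanTwoHolesReduction

/-!
# Grynkiewicz 2009, Theorem 4.1 for finite `G`: reduction to the case `l = 4` of Claim 5 and the deep core

[cite: Grynkiewicz2009, §6 (proof of Thm 4.1, pp. 23–28)] [tag: critical-pair] [tag: inverse-theorem]

Topic `Literature/Combinatorics/Additive`.  Cell `mm-stpp` (D-0046), seat `mm-stpp-lit` (gen 23); the
port of D. J. Grynkiewicz, *A step beyond Kemperman's structure theorem*, Mathematika **55** (2009)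
67–114 continued.  The checkpoint `conclusion_of_claim5_of_deepCore` (`StepBeyondKempermanCheckpoint.lean`)
took Claim 5 whole as a hypothesis; since then Claim 5 has been ported up to its last printed case
(`seventeen_or_fourPairs`, `StepBeyondKempermanTwoHolesReduction.lean`).  This file substitutes the
one for the other: for FINITE `G`, Theorem 4.1 (first part) follows from
* **the case `l = 4` of Claim 5** (print pp. 25 bottom – 26): in the frame delivered by
  `seventeen_or_fourPairs` (maximal period `H = H(P)` of order `2`, `P = (A + B) ∪ {γ₁, γ₂} = A + B + H`,
  `ρ = |H| + 2`, (40), the two relevant pairs `(x, y), (x′, y′)` with all four coset pairs relevant,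
  every relevant `a ≡ x, x′` and `b ≡ y, y′`, the one-hole structure, `γ₁ ≢ γ₂`) the conclusion of
  Theorem 4.1 holds (the print obtains type (VIII)); inputs already in tree: KST for
  `(φ_H(A), φ_H(B))` (`exists_isKempermanDecompI_image_mk`), the Klein group and (42)
  (`StepBeyondKempermanFourPairs.lean`), type (III) and type (II) excluded
  (`KempermanTypeThreePeriodic.lean`, `KempermanTypeTwoFourPairs.lean`); and
* **the deep core** (unchanged from the checkpoint: Claims 9–10 and Subcases 1–4).

MAIN RESULT (0 definitions, 0 named facts; everything PROVED).
* `Grynkiewicz2009.conclusion_of_fourPairs_of_deepCore`.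

## References
* D. J. Grynkiewicz, *A step beyond Kemperman's structure theorem*, Mathematika 55 (2009) 67–114,
  doi:10.1112/S0025579300000966, §6 (proof of Thm 4.1) [cite: Grynkiewicz2009, Thm 4.1 (proof)] —
  held `paper:doi-10-1112-s0025579300000966`, pp. 23–28 read 2026-08-29.
-/

namespace Literature.Combinatorics.Additive

open Finset
open scoped Pointwise

universe u

variable {G : Type u} [AddCommGroup G] [DecidableEq G]

namespace Grynkiewicz2009

/-- **Theorem 4.1 (first part) for finite `G`, modulo the case `l = 4` of Claim 5 and the deep
core.**  As `conclusion_of_claim5_of_deepCore`, with the hypothesis «Claim 5» replaced by its last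
printed case: for every subgroup `G′`, all `A, B ⊆ G′` with the core-case assumptions, and all data
`H, Hf, γ₁, γ₂, x, y, x′, y′` of the `l = 4` frame (the conjunction produced by
`seventeen_or_fourPairs`), the conclusion of Theorem 4.1 holds for `(A, B)`.
[cite: Grynkiewicz2009, §6 (proof of Thm 4.1), Claim 5 (pp. 24–26)] -/
theorem conclusion_of_fourPairs_of_deepCore [Fintype G]
    (fourPairs : ∀ (G' : AddSubgroup G) [Fintype ↥G'] (A B : Finset ↥G'),
      (0 : ↥G') ∈ A → (0 : ↥G') ∈ B → 3 ≤ #A → 3 ≤ #B → #(A + B) = #A + #B →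
      (A + B).addStab = {0} →
      (∀ P : Finset ↥G', A + B ⊆ P → P.addStab ≠ {0} → 2 ≤ #(P \ (A + B))) →
      IsNonExtendible A B → IsNonExtendible B A → ¬ IsQuasiPeriodic A → ¬ IsQuasiPeriodic B →
      AddSubgroup.closure (A : Set ↥G') = ⊤ → AddSubgroup.closure (B : Set ↥G') = ⊤ →
      ∀ (H : AddSubgroup ↥G') (Hf : Finset ↥G') (γ₁ γ₂ x y x' y' : ↥G'),
      ((∀ g, g ∈ Hf ↔ g ∈ H) ∧ #Hf = 2 ∧ (insert γ₁ (insert γ₂ (A + B))).addStab = Hf ∧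
        γ₁ ∉ A + B ∧ γ₂ ∉ A + B ∧ γ₁ ≠ γ₂ ∧ γ₁ - γ₂ ∉ H ∧
        insert γ₁ (insert γ₂ (A + B)) = A + B + Hf ∧
        #(A + Hf) + #(B + Hf) = #A + #B + #Hf + 2 ∧
        cosetCount H (A + B) + 1 = cosetCount H A + cosetCount H B ∧
        x ∈ A ∧ y ∈ B ∧ x' ∈ A ∧ y' ∈ B ∧ x - x' ∉ H ∧ y - y' ∉ H ∧
        (x + y - γ₁ ∈ H ∨ x + y - γ₂ ∈ H) ∧ (x' + y' - γ₁ ∈ H ∨ x' + y' - γ₂ ∈ H) ∧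
        (x + y' - γ₁ ∈ H ∨ x + y' - γ₂ ∈ H) ∧ (x' + y - γ₁ ∈ H ∨ x' + y - γ₂ ∈ H) ∧
        (∀ u ∈ A, ∀ v ∈ B, (u + v - γ₁ ∈ H ∨ u + v - γ₂ ∈ H) → u - x ∈ H ∨ u - x' ∈ H) ∧
        (∀ u ∈ A, ∀ v ∈ B, (u + v - γ₁ ∈ H ∨ u + v - γ₂ ∈ H) → v - y ∈ H ∨ v - y' ∈ H) ∧
        #(A ∩ (x +ᵥ Hf)) + #(B ∩ (y +ᵥ Hf)) = 2 ∧ #(A ∩ (x' +ᵥ Hf)) + #(B ∩ (y' +ᵥ Hf)) = 2 ∧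
        (A + Hf) \ ((x +ᵥ Hf) ∪ (x' +ᵥ Hf)) ⊆ A ∧ (B + Hf) \ ((y +ᵥ Hf) ∪ (y' +ᵥ Hf)) ⊆ B) →
      ((∃ α β : ↥G', #(insert α A + insert β B) + 1 = #(insert α A) + #(insert β B)) ∨
        ∃ (K : AddSubgroup ↥G') (A₁ A₀ B₁ B₀ : Finset ↥G'), IsGrynkiewiczDecomp K A B A₁ A₀ B₁ B₀))
    (deep : ∀ (G' : AddSubgroup G) [Fintype ↥G'] (A B : Finset ↥G'),
      (0 : ↥G') ∈ A → (0 : ↥G') ∈ B → 3 ≤ #A → 4 ≤ #B → #(A + B) = #A + #B →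
      (A + B).addStab = {0} →
      (∀ P : Finset ↥G', A + B ⊆ P → P.addStab ≠ {0} → 3 ≤ #(P \ (A + B))) →
      IsNonExtendible A B → IsNonExtendible B A → ¬ IsQuasiPeriodic A → ¬ IsQuasiPeriodic B →
      AddSubgroup.closure (A : Set ↥G') = ⊤ → AddSubgroup.closure (B : Set ↥G') = ⊤ →
      2 ≤ subsetDist A {P | IsQuasiPeriodic P} → 2 ≤ subsetDist B {P | IsQuasiPeriodic P} →
      (∀ P : Finset ↥G', Aᶜ ⊆ P → P.addStab ≠ {0} → 3 ≤ #(P \ Aᶜ)) →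
      (∀ P : Finset ↥G', Bᶜ ⊆ P → P.addStab ≠ {0} → 3 ≤ #(P \ Bᶜ)) →
      2 ≤ subsetDist (A + B)ᶜ {P | IsQuasiPeriodic P} →
      (∀ d : ↥G', d ≠ 0 → 2 ≤ subsetDist A {P | IsQuasiProgression d P}) →
      (∀ d : ↥G', d ≠ 0 → 2 ≤ subsetDist B {P | IsQuasiProgression d P}) →
      (∀ d : ↥G', d ≠ 0 → 2 ≤ subsetDist (A + B)ᶜ {P | IsQuasiProgression d P}) →
      (∀ b ∈ B, #(layerWith A B 1 {b}) ≤ 1) → (∀ a ∈ A, #(layerWith B A 1 {a}) ≤ 1) →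
      ¬ (#A = 3 ∧ #(A + B)ᶜ = 3) →
      ((∃ α β : ↥G', #(insert α A + insert β B) + 1 = #(insert α A) + #(insert β B)) ∨
        ∃ (K : AddSubgroup ↥G') (A₁ A₀ B₁ B₀ : Finset ↥G'), IsGrynkiewiczDecomp K A B A₁ A₀ B₁ B₀))
    {A B : Finset G} (hA : A.Nonempty) (hB : B.Nonempty) (hAB : #(A + B) = #A + #B)
    (haper : (A + B).addStab = {0}) :
    (∃ α β : G, #(insert α A + insert β B) + 1 = #(insert α A) + #(insert β B)) ∨
      ∃ (K : AddSubgroup G) (A₁ A₀ B₁ B₀ : Finset G), IsGrynkiewiczDecomp K A B A₁ A₀ B₁ B₀ := by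
  refine conclusion_of_claim5_of_deepCore ?_ deep hA hB hAB haper
  intro G' _ A B h0A h0B hA3 hB3 hAB haper hP2 hneA hneB hAqp hBqp hgenA hgenB hP
  obtain ⟨P, hPsub, hPper, hPle⟩ := hP
  rcases seventeen_or_fourPairs h0A h0B hAB haper hP2 hneA hneB hAqp hBqp hgenA hgenB hPsub hPper hPle
    with h17 | ⟨H, Hf, γ₁, γ₂, x, y, x', y', hframe⟩
  · exact Or.inl h17
  · exact fourPairs G' A B h0A h0B hA3 hB3 hAB haper hP2 hneA hneB hAqp hBqp hgenA hgenB H Hf γ₁ γ₂ x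
      y x' y' hframe

end Grynkiewicz2009

end Literature.Combinatorics.Additive
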